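/-
Copyright (c) 2026 the pub-hodgecm-mathlib formalisation cell (harness21).  Prover seat hodgecm-mathlib-K2E3-p06 (g3), Track B «K2-LIT» ∕ h413, road J ∕ R3 (d)
brick (d-w-0) «exact Euler–Poincaré indices at a ramified place», FILE C (the place): dealer K2E3-plan (g2) 2026-09-04T01:34:25Z (D16).  2026-09-04.
-/
import Literature.NumberTheory.Rogawski1990.RankOneEulerPoincareNonsplitRamifiedPackage   -- ★ (B-p14) the levels `K♯_D`, `K♯_D ⊓ K` on `U₂`: `mem_comap_map_conj_glInt_iff`, compact-open facts
import Literature.NumberTheory.Automorphic.UnitaryTwoRamifiedTreeStabilizersPlace          -- ★ (F0P3a-p04) the four (W2) stabiliser heads over ★ `rhoVertexActPlace` (B-p08: action, `hV`, `hD`)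
import Literature.NumberTheory.Automorphic.RamifiedPlaceAntiFixedDichotomy                  -- ★ (B-p14) `exists_units_galAdicCompletionMap_complexConj_eq_neg_of_ramified` (√u ∕ √π types)
import Literature.NumberTheory.Automorphic.LocalUnitaryIntegralLevel                        -- ★ `mem_localIntegralLevel_iff_of_smul_eq` (`K` through the one-place model)
import Literature.NumberTheory.Automorphic.UnitaryGroupIntegralPointsReductionInert          -- ★ `natCard_residueField_valuativeRel_eq` (`#𝓀[L⁺_v] = #(𝓞_{L⁺} ∕ v)`)
import Literature.NumberTheory.Automorphic.AdicCompletionLocalField                         -- ★ `IsNonarchimedeanLocalField (v.adicCompletion L⁺)` (finite residue field)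
import Literature.NumberTheory.Automorphic.SLTwoTreeRegular                                 -- ★ FILE B2 (this seat): `ncard_neighborSet_eq` (the tree of `SL₂(L⁺_v)` is `(q+1)`-regular)
import Literature.NumberTheory.GaloisRepresentations.HeckeCharacter                         -- ★ `HeckeCharacter.valued_uniformizer`
import Literature.Combinatorics.SimpleGraph.DartTransitiveStabilizerIndex                   -- ★ FILE A (this seat): `relIndex_inf_vertexStab_and_edgeStab`
import HarnessLib

/-!
# K2_E3 road (h413), U3b ROAD J, letter ‹J3› place class (d-w): THE TWO EXACT EULER–POINCARÉ INDICES `[K_vertex : I] = q + 1`, `[K_edge : I] = 2`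
# of `U(Φ₂)(L⁺_v)` AT A RAMIFIED NON-SPLIT PLACE — tame or wild (Kottwitz 1988 §2; Serre, *Trees* II.1; Tits 1979 §2.7)

`Summits/HodgeConjecture/HodgeConjecture/Theorems/K2E3RamifiedPlaceEPIndices.lean`; namespace `Summit.HodgeConjecture.HodgeConjecture.Cruxes.H413.K2E3RamifiedPlaceEPIndices`.
THEOREMS ONLY (no definition, no instance, no notation, no named fact, no `sorry`); kernel lane `--supports stmt-HodgeConjecture-24833 --as helper`.  Cell `pub/hodgecm-mathlib`,
Track B «K2-LIT», squad K2E3 «EllipticInputs», unit U3b `…Sigs_U3bCentralGerms`, road J letter ‹J3› `sig_K2E3CompatibleMeasureEPIdentityRankOne` (v2), R3 place class **(d-w)**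
(K2E3-p06 (g3) CENSUS `CENSUS-J3d-dyadic` §1∕§5), brick **(d-w-0)** (dealer K2E3-plan (g2) (D16) 2026-09-04T01:34:25Z).  HONEST LABEL: HC_CM is proved only modulo the 7 printed
citations (2 remaining named inputs: hLiu418 = stmt-HodgeConjecture-24832, h413 = stmt-HodgeConjecture-24833) until rung 0 closes; count-neutral helper (no socket is closed; it supplies
the EP-side number `r·ν₂(I) = (q−1)∕(2(q+1))` of ‹J3› at every ramified place through ★ R2 `K2E3EPValueIndexForm`, and upgrades the INEQUALITY ★ p855541
`toReal_inv_add_toReal_inv_lt_of_ramified` of J2♯'s ramified leaf to the two equalities).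

## The statement

`L` CM, `v` a finite place of `L⁺`, `w ∣ v` fixed by complex conjugation and RAMIFIED (`e(w|v) ≠ 1`; NO hypothesis on `|2|`: tame and wild alike), `η` a uniformiser of `L_w`,
`q = #(𝓞_{L⁺} ∕ v)`.  On `U₂ = U(Φ₂)(L⁺_v) = (cmDatum L 2 Φ₂).Local v` take the levels of J2♯'s ramified leaf ★ `RankOneEulerPoincareNonsplitCentralValueRamified` VERBATIM:
`K = cmLocalIntegralLevel` (`= U₂ ∩ GL₂(𝒪_w)` through the one-place model `e_w`), `K♯_η = {k : e_w k ∈ diag(1,η) GL₂(𝒪_w) diag(1,η)⁻¹}`, `I = K♯_η ⊓ K`.  Then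
KEYED on an anti-fixed `α ∈ L_wˣ` (`σ_w α = −α`): **`relIndex_vertexEdgeLevels_of_antifixed_unit`** (`|α| = 1`, √u-type, wild only: `[K : I] = q + 1 ∧ [K♯_η : I] = 2`) and
**`relIndex_vertexEdgeLevels_of_antifixed_uniformizer`** (`|α| = |ϖ_w|`, √π-type: `[K : I] = 2 ∧ [K♯_η : I] = q + 1`); type-blind
**`relIndex_vertexEdgeLevels_of_ramified`: `([K : I] = q + 1 ∧ [K♯_η : I] = 2) ∨ ([K : I] = 2 ∧ [K♯_η : I] = q + 1)`**, and the type-free consequence **`inv_relIndex_add_inv_relIndex_of_ramified`: `[K : I]⁻¹ + [K♯_η : I]⁻¹ = (q+1)⁻¹ + 2⁻¹`** — so Kottwitz's three-term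
Euler–Poincaré value is `f_EP(1)·ν(I) = (q+1)⁻¹ + 2⁻¹ − 1 = −(q−1)∕(2(q+1))` (★ R2 `epCombination_apply_mul_toReal_measure`).

## The proof (ROAD W's tree action + orbit–stabiliser)

★ B-p08's action `ρ_w = rhoVertexActPlace` of the one-place model `U_w` on the tree `X` of `SL₂(L⁺_v)` (one vertex orbit, ONE DART ORBIT ★ `exists_rhoVertexActPlace_eq_of_adj`),
pulled back to `U₂` along `e_w` (★ `localNonsplitEquiv`); the anti-fixed dichotomy ★ `exists_units_galAdicCompletionMap_complexConj_eq_neg_of_ramified` and the (W2) heads ★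
`UnitaryTwoRamifiedTreeStabilizersPlace`: `α` a UNIT ⇒ `K = Stab(v₀)`, `K♯_η = Stab{v₀, v₁}`; `α` a UNIFORMISER ⇒ `K♯_η = Stab(v₁)`, `K = Stab{v₁, v₀}` (`v₀ = 𝒪²`,
`v₁ = latt diag(1, ϖ_{L⁺_v})`).  ★ FILE A `relIndex_inf_vertexStab_and_edgeStab`: `[K_vertex : I] = #star`, `[K_edge : I] = 2`; ★ FILE B2 `ncard_neighborSet_eq`: every star of the
tree of `SL₂(L⁺_v)` has `#𝓀[L⁺_v] + 1 = q + 1` elements (★ `natCard_residueField_valuativeRel_eq`).  [Kottwitz1988 §2 (the indices of the EP levels); Serre1980Trees II.1.1–1.3;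
Tits1979 §2.7, §3.9 (ramified `U(1,1)`: special vertex of valency `q+1`, non-special of valency `2` in the subdivided apartment picture).]

## References
* [Kottwitz1988] R. E. Kottwitz, *Tamagawa numbers*, Ann. of Math. 127 (1988), 629–646, §2 Theorem 2.
* [Serre1980Trees] J.-P. Serre, *Trees* (1980), Ch. I §3.1, Ch. II §1.1–§1.3.
* [Tits1979] J. Tits, *Reductive groups over local fields*, PSPM 33.1 (1979), §2.7, §3.9.
* [Rogawski1990] J. D. Rogawski, *Automorphic Representations of Unitary Groups in Three Variables* (1990), §12.6 p. 174.
-/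

set_option autoImplicit false
-- the mandated namespace repeats the single-problem summit's segment (`HodgeConjecture.HodgeConjecture`), as in every `Theorems/*.lean` of this sub-problem
set_option linter.dupNamespace false

noncomputable section

open scoped ValuativeRel Matrix MatrixGroups WithZero
open Matrix ValuativeRel NumberField IsDedekindDomain
open Literature.NumberTheory.Automorphic Literature.NumberTheory.Automorphic.UnitaryGroup Literature.NumberTheory.Automorphic.HermitianLatticeTree
  Literature.NumberTheory.GaloisRepresentations Literature.Combinatorics.SimpleGraph

namespace Summit.HodgeConjecture.HodgeConjecture.Cruxes.H413.K2E3RamifiedPlaceEPIndices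

variable (L : Type) [Field L] [NumberField L] [IsCMField L] {v : HeightOneSpectrum (𝓞 ↥(maximalRealSubfield L))}
  (w : PlacesOver L v) (hw : IsCMField.complexConj L • w.1 = w.1)

set_option maxHeartbeats 800000 in  -- HB: the (W2) heads and the one-place model unfold `cmDatum.Local` ≡ `«local»` definitionally along `localNonsplitEquiv` (as in ★ J2♯ leaf 2b)
/-- **√u-TYPE (an anti-fixed UNIT `α` exists — only at WILD places): `[K : I] = q + 1`, `[K♯_η : I] = 2`** for J2♯'s ramified levels at ANY uniformiser `η` of `L_w`
(`K` is the stabiliser of the vertex `v₀ = 𝒪²` of the tree of `SL₂(L⁺_v)`, `K♯_η` that of the edge `{v₀, v₁}`; ★ FILE A orbit–stabiliser + ★ FILE B2 valency).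
[cite: Kottwitz1988, §2 Theorem 2] [cite: Serre1980Trees, Ch. II §1.1–§1.3] [cite: Tits1979, §2.7 and §3.9] -/
theorem relIndex_vertexEdgeLevels_of_antifixed_unit (he : v.asIdeal.ramificationIdx' w.1.asIdeal ≠ 1)
    (α : (w.1.adicCompletion L)ˣ) (hα : galAdicCompletionMap (L := L) (IsCMField.complexConj L) hw (α : w.1.adicCompletion L) = -(α : w.1.adicCompletion L))
    (hvα : Valued.v (α : w.1.adicCompletion L) = 1) (η : (w.1.adicCompletion L)ˣ) (hη : Valued.v (η : w.1.adicCompletion L) = WithZero.exp (-1 : ℤ)) :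
    ((((glInt 2 (w.1.adicCompletion L)).map (MulAut.conj (glDiagonal 2 (w.1.adicCompletion L) ![1, η])).toMonoidHom).comap
        (((unitaryGroupOfForm (galAdicCompletionMap (L := L) (IsCMField.complexConj L) hw) (placeForm (Matrix.of fun i j : Fin 2 => if i.val + j.val + 1 = 2 then (1 : L) else 0) w.1)).subtype.comp
          (localNonsplitEquiv (IsCMField.complexConj L) (Matrix.of fun i j : Fin 2 => if i.val + j.val + 1 = 2 then (1 : L) else 0) (IsCMField.complexConj_ne_one L) w hw).toMonoidHom :
          (cmDatum L 2 (Matrix.of fun i j : Fin 2 => if i.val + j.val + 1 = 2 then (1 : L) else 0)).Local v →* GL (Fin 2) (w.1.adicCompletion L)))) ⊓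
        cmLocalIntegralLevel L 2 (Matrix.of fun i j : Fin 2 => if i.val + j.val + 1 = 2 then (1 : L) else 0) v).relIndex
        (cmLocalIntegralLevel L 2 (Matrix.of fun i j : Fin 2 => if i.val + j.val + 1 = 2 then (1 : L) else 0) v) = Nat.card (𝓞 ↥(maximalRealSubfield L) ⧸ v.asIdeal) + 1 ∧
      ((((glInt 2 (w.1.adicCompletion L)).map (MulAut.conj (glDiagonal 2 (w.1.adicCompletion L) ![1, η])).toMonoidHom).comap
        (((unitaryGroupOfForm (galAdicCompletionMap (L := L) (IsCMField.complexConj L) hw) (placeForm (Matrix.of fun i j : Fin 2 => if i.val + j.val + 1 = 2 then (1 : L) else 0) w.1)).subtype.comp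
          (localNonsplitEquiv (IsCMField.complexConj L) (Matrix.of fun i j : Fin 2 => if i.val + j.val + 1 = 2 then (1 : L) else 0) (IsCMField.complexConj_ne_one L) w hw).toMonoidHom :
          (cmDatum L 2 (Matrix.of fun i j : Fin 2 => if i.val + j.val + 1 = 2 then (1 : L) else 0)).Local v →* GL (Fin 2) (w.1.adicCompletion L)))) ⊓
        cmLocalIntegralLevel L 2 (Matrix.of fun i j : Fin 2 => if i.val + j.val + 1 = 2 then (1 : L) else 0) v).relIndex
        (((glInt 2 (w.1.adicCompletion L)).map (MulAut.conj (glDiagonal 2 (w.1.adicCompletion L) ![1, η])).toMonoidHom).comap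
        (((unitaryGroupOfForm (galAdicCompletionMap (L := L) (IsCMField.complexConj L) hw) (placeForm (Matrix.of fun i j : Fin 2 => if i.val + j.val + 1 = 2 then (1 : L) else 0) w.1)).subtype.comp
          (localNonsplitEquiv (IsCMField.complexConj L) (Matrix.of fun i j : Fin 2 => if i.val + j.val + 1 = 2 then (1 : L) else 0) (IsCMField.complexConj_ne_one L) w hw).toMonoidHom :
          (cmDatum L 2 (Matrix.of fun i j : Fin 2 => if i.val + j.val + 1 = 2 then (1 : L) else 0)).Local v →* GL (Fin 2) (w.1.adicCompletion L)))) = 2 := by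
  classical
  set Ksh := ((glInt 2 (w.1.adicCompletion L)).map (MulAut.conj (glDiagonal 2 (w.1.adicCompletion L) ![1, η])).toMonoidHom).comap
          (((unitaryGroupOfForm (galAdicCompletionMap (L := L) (IsCMField.complexConj L) hw) (placeForm (Matrix.of fun i j : Fin 2 => if i.val + j.val + 1 = 2 then (1 : L) else 0) w.1)).subtype.comp
            (localNonsplitEquiv (IsCMField.complexConj L) (Matrix.of fun i j : Fin 2 => if i.val + j.val + 1 = 2 then (1 : L) else 0)
          (IsCMField.complexConj_ne_one L) w hw).toMonoidHom :
            (cmDatum L 2 (Matrix.of fun i j : Fin 2 => if i.val + j.val + 1 = 2 then (1 : L) else 0)).Local v →* GL (Fin 2) (w.1.adicCompletion L))) with hKsh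
  set K := cmLocalIntegralLevel L 2 (Matrix.of fun i j : Fin 2 => if i.val + j.val + 1 = 2 then (1 : L) else 0) v with hKdef
  have hc1 : IsCMField.complexConj L ≠ 1 := IsCMField.complexConj_ne_one L
  have hα0 : (α : w.1.adicCompletion L) ≠ 0 := α.ne_zero
  -- a uniformiser `ϖ_F` of `L⁺_v`; the tree of `SL₂(L⁺_v)` and its reference dart `(v₀, v₁) = (𝒪², latt diag(1, ϖ_F))`
  obtain ⟨ϖF, hϖF⟩ : ∃ ϖF : v.adicCompletion ↥(maximalRealSubfield L), Valued.v ϖF = WithZero.exp (-1 : ℤ) :=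
    ⟨_, HeckeCharacter.valued_uniformizer (K := ↥(maximalRealSubfield L)) (v := v)⟩
  haveI : IsDiscreteValuationRing 𝒪[v.adicCompletion ↥(maximalRealSubfield L)] := isDiscreteValuationRing_integer_of_compatible hϖF
  have hϖ : IsUniformizingElement ϖF := isUniformizingElement_of_v_eq hϖF
  obtain ⟨g₁, hg₁, hdet₁⟩ := exists_coe_eq_diagonal_one_uniformizer (F := v.adicCompletion ↥(maximalRealSubfield L)) hϖ.ne_zero
  obtain ⟨v₀, v₁, hv₀, hv₁⟩ : ∃ v₀ v₁ : {M : Submodule 𝒪[v.adicCompletion ↥(maximalRealSubfield L)] (Fin 2 → v.adicCompletion ↥(maximalRealSubfield L)) //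
      IsSpecialLattice (RingHom.id _) ϖF !![(0 : v.adicCompletion ↥(maximalRealSubfield L)), 1; -1, 0] M},
      v₀.1 = latt (1 : Matrix (Fin 2) (Fin 2) (v.adicCompletion ↥(maximalRealSubfield L))) ∧
        v₁.1 = latt (Matrix.diagonal ![(1 : v.adicCompletion ↥(maximalRealSubfield L)), ϖF]) :=
    ⟨⟨latt (1 : Matrix (Fin 2) (Fin 2) (v.adicCompletion ↥(maximalRealSubfield L))),
        Or.inl ((isSelfDualLattice_id_altJ_iff _).2 ⟨1, by rw [Units.val_one], by rw [Units.val_one, det_one, map_one]⟩)⟩,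
      ⟨latt (Matrix.diagonal ![(1 : v.adicCompletion ↥(maximalRealSubfield L)), ϖF]),
        Or.inr ((isModularLattice_id_altJ_iff hϖ.ne_zero _).2 ⟨g₁, by rw [hg₁], by rw [hdet₁]⟩)⟩, rfl, rfl⟩
  have h01 := latticeTree_adj_root hϖ v₀ v₁ hv₀ hv₁
  -- the stars: `q + 1` neighbours at every vertex (★ FILE B2), `q = #𝓀[L⁺_v] = #(𝓞_{L⁺} ∕ v)`
  have hq : Nat.card 𝓀[v.adicCompletion ↥(maximalRealSubfield L)] = Nat.card (𝓞 ↥(maximalRealSubfield L) ⧸ v.asIdeal) :=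
    natCard_residueField_valuativeRel_eq v
  -- the action of `U₂` through the one-place model `e_w`
  set e := localNonsplitEquiv (IsCMField.complexConj L) (Matrix.of fun i j : Fin 2 => if i.val + j.val + 1 = 2 then (1 : L) else 0) hc1 w hw with hedef
  set act : (cmDatum L 2 (Matrix.of fun i j : Fin 2 => if i.val + j.val + 1 = 2 then (1 : L) else 0)).Local v →
      {M : Submodule 𝒪[v.adicCompletion ↥(maximalRealSubfield L)] (Fin 2 → v.adicCompletion ↥(maximalRealSubfield L)) //
        IsSpecialLattice (RingHom.id _) ϖF !![(0 : v.adicCompletion ↥(maximalRealSubfield L)), 1; -1, 0] M} →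
      {M : Submodule 𝒪[v.adicCompletion ↥(maximalRealSubfield L)] (Fin 2 → v.adicCompletion ↥(maximalRealSubfield L)) //
        IsSpecialLattice (RingHom.id _) ϖF !![(0 : v.adicCompletion ↥(maximalRealSubfield L)), 1; -1, 0] M} :=
    fun k x => rhoVertexActPlace L v w hw hα hα0 hϖF (e k) x with hact
  have act_one : ∀ x, act 1 x = x := fun x => by
    simp only [hact]; exact rhoVertexActPlace_one L v w hw hα hα0 hϖF x
  have act_mul : ∀ g h x, act (g * h) x = act g (act h x) := fun g h x => by
    simp only [hact]; exact rhoVertexActPlace_mul L v w hw hα hα0 hϖF (e g) (e h) x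
  have act_adj : ∀ g x y, (latticeTree (RingHom.id _) ϖF !![(0 : v.adicCompletion ↥(maximalRealSubfield L)), 1; -1, 0]).Adj x y →
      (latticeTree (RingHom.id _) ϖF !![(0 : v.adicCompletion ↥(maximalRealSubfield L)), 1; -1, 0]).Adj (act g x) (act g y) :=
    fun g x y hxy => (latticeTree_adj_rhoVertexActPlace_iff L v w hw hα hα0 hϖF (e g) x y).2 hxy
  -- the levels through `e_w`
  have hK : ∀ k, k ∈ K ↔ ((e k : ↥(unitaryGroupOfForm (galAdicCompletionMap (L := L) (IsCMField.complexConj L) hw)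
      (placeForm (Matrix.of fun i j : Fin 2 => if i.val + j.val + 1 = 2 then (1 : L) else 0) w.1))) : GL (Fin 2) (w.1.adicCompletion L)) ∈ glInt 2 (w.1.adicCompletion L) :=
    fun k => mem_localIntegralLevel_iff_of_smul_eq (IsCMField.complexConj L) 2 _ hc1 w hw k
  have hS : ∀ k, k ∈ Ksh ↔ ((e k : ↥(unitaryGroupOfForm (galAdicCompletionMap (L := L) (IsCMField.complexConj L) hw)
      (placeForm (Matrix.of fun i j : Fin 2 => if i.val + j.val + 1 = 2 then (1 : L) else 0) w.1))) : GL (Fin 2) (w.1.adicCompletion L)) ∈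
        (glInt 2 (w.1.adicCompletion L)).map (MulAut.conj (glDiagonal 2 (w.1.adicCompletion L) ![1, η])).toMonoidHom :=
    fun k => mem_comap_map_conj_glInt_iff L w hw (glDiagonal 2 (w.1.adicCompletion L) ![1, η]) k
  -- `L_w = L⁺_v(√u)`-TYPE (`α` an anti-fixed UNIT): `K`-vertex `x₀ = v₀`, `K♯_η`-edge `{v₀, v₁}`
  have hstar0 := ncard_neighborSet_eq hϖF v₀ v₁ hv₀ hv₁ v₀
  have hD : ∀ a b, (latticeTree (RingHom.id _) ϖF !![(0 : v.adicCompletion ↥(maximalRealSubfield L)), 1; -1, 0]).Adj a b →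
      ∃ g, act g v₀ = a ∧ act g v₁ = b := fun a b hab => by
    obtain ⟨u, hu0, hu1⟩ := exists_rhoVertexActPlace_eq_of_adj L v w hw hα hα0 hϖF he v₀ v₁ hv₀ hv₁ hab
    exact ⟨e.symm u, by simp only [hact, ContinuousMulEquiv.apply_symm_apply]; exact hu0,
      by simp only [hact, ContinuousMulEquiv.apply_symm_apply]; exact hu1⟩
  have hKv : ∀ k, k ∈ K ↔ act k v₀ = v₀ := fun k =>
    (hK k).trans (forall_coe_mem_glInt_iff_rhoVertexActPlace_root_eq L v w hw hα hα0 hϖF v₀ hv₀ hvα (e k))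
  have hKe : ∀ k, k ∈ Ksh ↔ s(act k v₀, act k v₁) = s(v₀, v₁) := fun k =>
    (hS k).trans (forall_coe_mem_map_conj_glDiagonal_iff_sym2_rhoVertexActPlace_eq L v w hw hα hα0 hϖF v₀ v₁ hv₀ hv₁ he hvα η hη (e k))
  obtain ⟨h1, h2⟩ := relIndex_inf_vertexStab_and_edgeStab _ act act_one act_mul act_adj h01 hD K Ksh hKv hKe
  rw [inf_comm] at h1 h2
  exact ⟨by rw [h1, hstar0, hq], h2⟩

set_option maxHeartbeats 800000 in  -- HB: as above (one-place-model binders)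
/-- **√π-TYPE (an anti-fixed UNIFORMISER `α` exists — every tame place, and the wild places of `L⁺_v(√π)`-type): `[K : I] = 2`, `[K♯_η : I] = q + 1`** for J2♯'s ramified
levels at ANY uniformiser `η` (`K♯_η` is the stabiliser of the vertex `v₁ = latt diag(1, ϖ_{L⁺_v})`, `K` that of the edge `{v₁, v₀}`); generalises ★ (E-ram) §2
`relIndex_sharp_inf_level_eq_of_antifixed_uniformizer` (there `η = α`, via ★ LH4-p05 F7) to every `η`, by an independent road.
[cite: Kottwitz1988, §2 Theorem 2] [cite: Serre1980Trees, Ch. II §1.1–§1.3] [cite: Tits1979, §2.7 and §3.9] -/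
theorem relIndex_vertexEdgeLevels_of_antifixed_uniformizer (he : v.asIdeal.ramificationIdx' w.1.asIdeal ≠ 1)
    (α : (w.1.adicCompletion L)ˣ) (hα : galAdicCompletionMap (L := L) (IsCMField.complexConj L) hw (α : w.1.adicCompletion L) = -(α : w.1.adicCompletion L))
    (hvα : Valued.v (α : w.1.adicCompletion L) = WithZero.exp (-1 : ℤ)) (η : (w.1.adicCompletion L)ˣ) (hη : Valued.v (η : w.1.adicCompletion L) = WithZero.exp (-1 : ℤ)) :
    ((((glInt 2 (w.1.adicCompletion L)).map (MulAut.conj (glDiagonal 2 (w.1.adicCompletion L) ![1, η])).toMonoidHom).comap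
        (((unitaryGroupOfForm (galAdicCompletionMap (L := L) (IsCMField.complexConj L) hw) (placeForm (Matrix.of fun i j : Fin 2 => if i.val + j.val + 1 = 2 then (1 : L) else 0) w.1)).subtype.comp
          (localNonsplitEquiv (IsCMField.complexConj L) (Matrix.of fun i j : Fin 2 => if i.val + j.val + 1 = 2 then (1 : L) else 0) (IsCMField.complexConj_ne_one L) w hw).toMonoidHom :
          (cmDatum L 2 (Matrix.of fun i j : Fin 2 => if i.val + j.val + 1 = 2 then (1 : L) else 0)).Local v →* GL (Fin 2) (w.1.adicCompletion L)))) ⊓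
        cmLocalIntegralLevel L 2 (Matrix.of fun i j : Fin 2 => if i.val + j.val + 1 = 2 then (1 : L) else 0) v).relIndex
        (cmLocalIntegralLevel L 2 (Matrix.of fun i j : Fin 2 => if i.val + j.val + 1 = 2 then (1 : L) else 0) v) = 2 ∧
      ((((glInt 2 (w.1.adicCompletion L)).map (MulAut.conj (glDiagonal 2 (w.1.adicCompletion L) ![1, η])).toMonoidHom).comap
        (((unitaryGroupOfForm (galAdicCompletionMap (L := L) (IsCMField.complexConj L) hw) (placeForm (Matrix.of fun i j : Fin 2 => if i.val + j.val + 1 = 2 then (1 : L) else 0) w.1)).subtype.comp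
          (localNonsplitEquiv (IsCMField.complexConj L) (Matrix.of fun i j : Fin 2 => if i.val + j.val + 1 = 2 then (1 : L) else 0) (IsCMField.complexConj_ne_one L) w hw).toMonoidHom :
          (cmDatum L 2 (Matrix.of fun i j : Fin 2 => if i.val + j.val + 1 = 2 then (1 : L) else 0)).Local v →* GL (Fin 2) (w.1.adicCompletion L)))) ⊓
        cmLocalIntegralLevel L 2 (Matrix.of fun i j : Fin 2 => if i.val + j.val + 1 = 2 then (1 : L) else 0) v).relIndex
        (((glInt 2 (w.1.adicCompletion L)).map (MulAut.conj (glDiagonal 2 (w.1.adicCompletion L) ![1, η])).toMonoidHom).comap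
        (((unitaryGroupOfForm (galAdicCompletionMap (L := L) (IsCMField.complexConj L) hw) (placeForm (Matrix.of fun i j : Fin 2 => if i.val + j.val + 1 = 2 then (1 : L) else 0) w.1)).subtype.comp
          (localNonsplitEquiv (IsCMField.complexConj L) (Matrix.of fun i j : Fin 2 => if i.val + j.val + 1 = 2 then (1 : L) else 0) (IsCMField.complexConj_ne_one L) w hw).toMonoidHom :
          (cmDatum L 2 (Matrix.of fun i j : Fin 2 => if i.val + j.val + 1 = 2 then (1 : L) else 0)).Local v →* GL (Fin 2) (w.1.adicCompletion L)))) = Nat.card (𝓞 ↥(maximalRealSubfield L) ⧸ v.asIdeal) + 1 := by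
  classical
  set Ksh := ((glInt 2 (w.1.adicCompletion L)).map (MulAut.conj (glDiagonal 2 (w.1.adicCompletion L) ![1, η])).toMonoidHom).comap
          (((unitaryGroupOfForm (galAdicCompletionMap (L := L) (IsCMField.complexConj L) hw) (placeForm (Matrix.of fun i j : Fin 2 => if i.val + j.val + 1 = 2 then (1 : L) else 0) w.1)).subtype.comp
            (localNonsplitEquiv (IsCMField.complexConj L) (Matrix.of fun i j : Fin 2 => if i.val + j.val + 1 = 2 then (1 : L) else 0)
          (IsCMField.complexConj_ne_one L) w hw).toMonoidHom :
            (cmDatum L 2 (Matrix.of fun i j : Fin 2 => if i.val + j.val + 1 = 2 then (1 : L) else 0)).Local v →* GL (Fin 2) (w.1.adicCompletion L))) with hKsh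
  set K := cmLocalIntegralLevel L 2 (Matrix.of fun i j : Fin 2 => if i.val + j.val + 1 = 2 then (1 : L) else 0) v with hKdef
  have hc1 : IsCMField.complexConj L ≠ 1 := IsCMField.complexConj_ne_one L
  have hα0 : (α : w.1.adicCompletion L) ≠ 0 := α.ne_zero
  -- a uniformiser `ϖ_F` of `L⁺_v`; the tree of `SL₂(L⁺_v)` and its reference dart `(v₀, v₁) = (𝒪², latt diag(1, ϖ_F))`
  obtain ⟨ϖF, hϖF⟩ : ∃ ϖF : v.adicCompletion ↥(maximalRealSubfield L), Valued.v ϖF = WithZero.exp (-1 : ℤ) :=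
    ⟨_, HeckeCharacter.valued_uniformizer (K := ↥(maximalRealSubfield L)) (v := v)⟩
  haveI : IsDiscreteValuationRing 𝒪[v.adicCompletion ↥(maximalRealSubfield L)] := isDiscreteValuationRing_integer_of_compatible hϖF
  have hϖ : IsUniformizingElement ϖF := isUniformizingElement_of_v_eq hϖF
  obtain ⟨g₁, hg₁, hdet₁⟩ := exists_coe_eq_diagonal_one_uniformizer (F := v.adicCompletion ↥(maximalRealSubfield L)) hϖ.ne_zero
  obtain ⟨v₀, v₁, hv₀, hv₁⟩ : ∃ v₀ v₁ : {M : Submodule 𝒪[v.adicCompletion ↥(maximalRealSubfield L)] (Fin 2 → v.adicCompletion ↥(maximalRealSubfield L)) //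
      IsSpecialLattice (RingHom.id _) ϖF !![(0 : v.adicCompletion ↥(maximalRealSubfield L)), 1; -1, 0] M},
      v₀.1 = latt (1 : Matrix (Fin 2) (Fin 2) (v.adicCompletion ↥(maximalRealSubfield L))) ∧
        v₁.1 = latt (Matrix.diagonal ![(1 : v.adicCompletion ↥(maximalRealSubfield L)), ϖF]) :=
    ⟨⟨latt (1 : Matrix (Fin 2) (Fin 2) (v.adicCompletion ↥(maximalRealSubfield L))),
        Or.inl ((isSelfDualLattice_id_altJ_iff _).2 ⟨1, by rw [Units.val_one], by rw [Units.val_one, det_one, map_one]⟩)⟩,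
      ⟨latt (Matrix.diagonal ![(1 : v.adicCompletion ↥(maximalRealSubfield L)), ϖF]),
        Or.inr ((isModularLattice_id_altJ_iff hϖ.ne_zero _).2 ⟨g₁, by rw [hg₁], by rw [hdet₁]⟩)⟩, rfl, rfl⟩
  have h01 := latticeTree_adj_root hϖ v₀ v₁ hv₀ hv₁
  -- the stars: `q + 1` neighbours at every vertex (★ FILE B2), `q = #𝓀[L⁺_v] = #(𝓞_{L⁺} ∕ v)`
  have hq : Nat.card 𝓀[v.adicCompletion ↥(maximalRealSubfield L)] = Nat.card (𝓞 ↥(maximalRealSubfield L) ⧸ v.asIdeal) :=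
    natCard_residueField_valuativeRel_eq v
  -- the action of `U₂` through the one-place model `e_w`
  set e := localNonsplitEquiv (IsCMField.complexConj L) (Matrix.of fun i j : Fin 2 => if i.val + j.val + 1 = 2 then (1 : L) else 0) hc1 w hw with hedef
  set act : (cmDatum L 2 (Matrix.of fun i j : Fin 2 => if i.val + j.val + 1 = 2 then (1 : L) else 0)).Local v →
      {M : Submodule 𝒪[v.adicCompletion ↥(maximalRealSubfield L)] (Fin 2 → v.adicCompletion ↥(maximalRealSubfield L)) //
        IsSpecialLattice (RingHom.id _) ϖF !![(0 : v.adicCompletion ↥(maximalRealSubfield L)), 1; -1, 0] M} →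
      {M : Submodule 𝒪[v.adicCompletion ↥(maximalRealSubfield L)] (Fin 2 → v.adicCompletion ↥(maximalRealSubfield L)) //
        IsSpecialLattice (RingHom.id _) ϖF !![(0 : v.adicCompletion ↥(maximalRealSubfield L)), 1; -1, 0] M} :=
    fun k x => rhoVertexActPlace L v w hw hα hα0 hϖF (e k) x with hact
  have act_one : ∀ x, act 1 x = x := fun x => by
    simp only [hact]; exact rhoVertexActPlace_one L v w hw hα hα0 hϖF x
  have act_mul : ∀ g h x, act (g * h) x = act g (act h x) := fun g h x => by
    simp only [hact]; exact rhoVertexActPlace_mul L v w hw hα hα0 hϖF (e g) (e h) x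
  have act_adj : ∀ g x y, (latticeTree (RingHom.id _) ϖF !![(0 : v.adicCompletion ↥(maximalRealSubfield L)), 1; -1, 0]).Adj x y →
      (latticeTree (RingHom.id _) ϖF !![(0 : v.adicCompletion ↥(maximalRealSubfield L)), 1; -1, 0]).Adj (act g x) (act g y) :=
    fun g x y hxy => (latticeTree_adj_rhoVertexActPlace_iff L v w hw hα hα0 hϖF (e g) x y).2 hxy
  -- the levels through `e_w`
  have hK : ∀ k, k ∈ K ↔ ((e k : ↥(unitaryGroupOfForm (galAdicCompletionMap (L := L) (IsCMField.complexConj L) hw)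
      (placeForm (Matrix.of fun i j : Fin 2 => if i.val + j.val + 1 = 2 then (1 : L) else 0) w.1))) : GL (Fin 2) (w.1.adicCompletion L)) ∈ glInt 2 (w.1.adicCompletion L) :=
    fun k => mem_localIntegralLevel_iff_of_smul_eq (IsCMField.complexConj L) 2 _ hc1 w hw k
  have hS : ∀ k, k ∈ Ksh ↔ ((e k : ↥(unitaryGroupOfForm (galAdicCompletionMap (L := L) (IsCMField.complexConj L) hw)
      (placeForm (Matrix.of fun i j : Fin 2 => if i.val + j.val + 1 = 2 then (1 : L) else 0) w.1))) : GL (Fin 2) (w.1.adicCompletion L)) ∈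
        (glInt 2 (w.1.adicCompletion L)).map (MulAut.conj (glDiagonal 2 (w.1.adicCompletion L) ![1, η])).toMonoidHom :=
    fun k => mem_comap_map_conj_glInt_iff L w hw (glDiagonal 2 (w.1.adicCompletion L) ![1, η]) k
  -- `L_w = L⁺_v(√π)`-TYPE (`α` an anti-fixed UNIFORMISER): `K♯_η`-vertex `x₀ = v₁`, `K`-edge `{v₁, v₀}`
  have hstar1 := ncard_neighborSet_eq hϖF v₀ v₁ hv₀ hv₁ v₁
  have hD : ∀ a b, (latticeTree (RingHom.id _) ϖF !![(0 : v.adicCompletion ↥(maximalRealSubfield L)), 1; -1, 0]).Adj a b →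
      ∃ g, act g v₁ = a ∧ act g v₀ = b := fun a b hab => by
    obtain ⟨u, hu0, hu1⟩ := exists_rhoVertexActPlace_eq_of_adj' L v w hw hα hα0 hϖF he v₁ v₀ hv₁ hv₀ hab
    exact ⟨e.symm u, by simp only [hact, ContinuousMulEquiv.apply_symm_apply]; exact hu0,
      by simp only [hact, ContinuousMulEquiv.apply_symm_apply]; exact hu1⟩
  have hKv : ∀ k, k ∈ Ksh ↔ act k v₁ = v₁ := fun k =>
    (hS k).trans (forall_coe_mem_map_conj_glDiagonal_iff_rhoVertexActPlace_next_eq L v w hw hα hα0 hϖF v₁ hv₁ he hvα η hη (e k))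
  have hKe : ∀ k, k ∈ K ↔ s(act k v₁, act k v₀) = s(v₁, v₀) := fun k =>
    (hK k).trans (forall_coe_mem_glInt_iff_sym2_rhoVertexActPlace_eq L v w hw hα hα0 hϖF v₀ v₁ hv₀ hv₁ he hvα (e k))
  obtain ⟨h1, h2⟩ := relIndex_inf_vertexStab_and_edgeStab _ act act_one act_mul act_adj h01.symm hD Ksh K hKv hKe
  exact ⟨h2, by rw [h1, hstar1, hq]⟩

/-- **THE TWO EXACT EULER–POINCARÉ INDICES AT A RAMIFIED PLACE** (tame or wild, type-blind): with `K = cmLocalIntegralLevel`, `K♯_η` the `diag(1,η)`-conjugate level and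
`I = K♯_η ⊓ K` on `U(Φ₂)(L⁺_v)` (J2♯'s ramified levels verbatim), `([K : I] = q+1 ∧ [K♯_η : I] = 2) ∨ ([K : I] = 2 ∧ [K♯_η : I] = q+1)`, `q = #(𝓞_{L⁺} ∕ v)` — by the
anti-fixed dichotomy ★ `exists_units_galAdicCompletionMap_complexConj_eq_neg_of_ramified` and the two keyed theorems above.
[cite: Kottwitz1988, §2 Theorem 2] [cite: Serre1980Trees, Ch. II §1.1–§1.3] [cite: Tits1979, §2.7 and §3.9] -/
theorem relIndex_vertexEdgeLevels_of_ramified (he : v.asIdeal.ramificationIdx' w.1.asIdeal ≠ 1)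
    (η : (w.1.adicCompletion L)ˣ) (hη : Valued.v (η : w.1.adicCompletion L) = WithZero.exp (-1 : ℤ)) :
    (((((glInt 2 (w.1.adicCompletion L)).map (MulAut.conj (glDiagonal 2 (w.1.adicCompletion L) ![1, η])).toMonoidHom).comap
        (((unitaryGroupOfForm (galAdicCompletionMap (L := L) (IsCMField.complexConj L) hw) (placeForm (Matrix.of fun i j : Fin 2 => if i.val + j.val + 1 = 2 then (1 : L) else 0) w.1)).subtype.comp
          (localNonsplitEquiv (IsCMField.complexConj L) (Matrix.of fun i j : Fin 2 => if i.val + j.val + 1 = 2 then (1 : L) else 0) (IsCMField.complexConj_ne_one L) w hw).toMonoidHom :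
          (cmDatum L 2 (Matrix.of fun i j : Fin 2 => if i.val + j.val + 1 = 2 then (1 : L) else 0)).Local v →* GL (Fin 2) (w.1.adicCompletion L)))) ⊓
        cmLocalIntegralLevel L 2 (Matrix.of fun i j : Fin 2 => if i.val + j.val + 1 = 2 then (1 : L) else 0) v).relIndex
        (cmLocalIntegralLevel L 2 (Matrix.of fun i j : Fin 2 => if i.val + j.val + 1 = 2 then (1 : L) else 0) v) = Nat.card (𝓞 ↥(maximalRealSubfield L) ⧸ v.asIdeal) + 1 ∧
      ((((glInt 2 (w.1.adicCompletion L)).map (MulAut.conj (glDiagonal 2 (w.1.adicCompletion L) ![1, η])).toMonoidHom).comap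
        (((unitaryGroupOfForm (galAdicCompletionMap (L := L) (IsCMField.complexConj L) hw) (placeForm (Matrix.of fun i j : Fin 2 => if i.val + j.val + 1 = 2 then (1 : L) else 0) w.1)).subtype.comp
          (localNonsplitEquiv (IsCMField.complexConj L) (Matrix.of fun i j : Fin 2 => if i.val + j.val + 1 = 2 then (1 : L) else 0) (IsCMField.complexConj_ne_one L) w hw).toMonoidHom :
          (cmDatum L 2 (Matrix.of fun i j : Fin 2 => if i.val + j.val + 1 = 2 then (1 : L) else 0)).Local v →* GL (Fin 2) (w.1.adicCompletion L)))) ⊓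
        cmLocalIntegralLevel L 2 (Matrix.of fun i j : Fin 2 => if i.val + j.val + 1 = 2 then (1 : L) else 0) v).relIndex
        (((glInt 2 (w.1.adicCompletion L)).map (MulAut.conj (glDiagonal 2 (w.1.adicCompletion L) ![1, η])).toMonoidHom).comap
        (((unitaryGroupOfForm (galAdicCompletionMap (L := L) (IsCMField.complexConj L) hw) (placeForm (Matrix.of fun i j : Fin 2 => if i.val + j.val + 1 = 2 then (1 : L) else 0) w.1)).subtype.comp
          (localNonsplitEquiv (IsCMField.complexConj L) (Matrix.of fun i j : Fin 2 => if i.val + j.val + 1 = 2 then (1 : L) else 0) (IsCMField.complexConj_ne_one L) w hw).toMonoidHom :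
          (cmDatum L 2 (Matrix.of fun i j : Fin 2 => if i.val + j.val + 1 = 2 then (1 : L) else 0)).Local v →* GL (Fin 2) (w.1.adicCompletion L)))) = 2) ∨
    (((((glInt 2 (w.1.adicCompletion L)).map (MulAut.conj (glDiagonal 2 (w.1.adicCompletion L) ![1, η])).toMonoidHom).comap
        (((unitaryGroupOfForm (galAdicCompletionMap (L := L) (IsCMField.complexConj L) hw) (placeForm (Matrix.of fun i j : Fin 2 => if i.val + j.val + 1 = 2 then (1 : L) else 0) w.1)).subtype.comp
          (localNonsplitEquiv (IsCMField.complexConj L) (Matrix.of fun i j : Fin 2 => if i.val + j.val + 1 = 2 then (1 : L) else 0) (IsCMField.complexConj_ne_one L) w hw).toMonoidHom :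
          (cmDatum L 2 (Matrix.of fun i j : Fin 2 => if i.val + j.val + 1 = 2 then (1 : L) else 0)).Local v →* GL (Fin 2) (w.1.adicCompletion L)))) ⊓
        cmLocalIntegralLevel L 2 (Matrix.of fun i j : Fin 2 => if i.val + j.val + 1 = 2 then (1 : L) else 0) v).relIndex
        (cmLocalIntegralLevel L 2 (Matrix.of fun i j : Fin 2 => if i.val + j.val + 1 = 2 then (1 : L) else 0) v) = 2 ∧
      ((((glInt 2 (w.1.adicCompletion L)).map (MulAut.conj (glDiagonal 2 (w.1.adicCompletion L) ![1, η])).toMonoidHom).comap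
        (((unitaryGroupOfForm (galAdicCompletionMap (L := L) (IsCMField.complexConj L) hw) (placeForm (Matrix.of fun i j : Fin 2 => if i.val + j.val + 1 = 2 then (1 : L) else 0) w.1)).subtype.comp
          (localNonsplitEquiv (IsCMField.complexConj L) (Matrix.of fun i j : Fin 2 => if i.val + j.val + 1 = 2 then (1 : L) else 0) (IsCMField.complexConj_ne_one L) w hw).toMonoidHom :
          (cmDatum L 2 (Matrix.of fun i j : Fin 2 => if i.val + j.val + 1 = 2 then (1 : L) else 0)).Local v →* GL (Fin 2) (w.1.adicCompletion L)))) ⊓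
        cmLocalIntegralLevel L 2 (Matrix.of fun i j : Fin 2 => if i.val + j.val + 1 = 2 then (1 : L) else 0) v).relIndex
        (((glInt 2 (w.1.adicCompletion L)).map (MulAut.conj (glDiagonal 2 (w.1.adicCompletion L) ![1, η])).toMonoidHom).comap
        (((unitaryGroupOfForm (galAdicCompletionMap (L := L) (IsCMField.complexConj L) hw) (placeForm (Matrix.of fun i j : Fin 2 => if i.val + j.val + 1 = 2 then (1 : L) else 0) w.1)).subtype.comp
          (localNonsplitEquiv (IsCMField.complexConj L) (Matrix.of fun i j : Fin 2 => if i.val + j.val + 1 = 2 then (1 : L) else 0) (IsCMField.complexConj_ne_one L) w hw).toMonoidHom :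
          (cmDatum L 2 (Matrix.of fun i j : Fin 2 => if i.val + j.val + 1 = 2 then (1 : L) else 0)).Local v →* GL (Fin 2) (w.1.adicCompletion L)))) = Nat.card (𝓞 ↥(maximalRealSubfield L) ⧸ v.asIdeal) + 1) := by
  obtain ⟨α, hα, hvα | hvα⟩ := exists_units_galAdicCompletionMap_complexConj_eq_neg_of_ramified L w hw he
  · exact Or.inl (relIndex_vertexEdgeLevels_of_antifixed_unit L w hw he α hα hvα η hη)
  · exact Or.inr (relIndex_vertexEdgeLevels_of_antifixed_uniformizer L w hw he α hα hvα η hη)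

/-- **TYPE-FREE FORM: `[K : I]⁻¹ + [K♯_η : I]⁻¹ = (q+1)⁻¹ + 2⁻¹`** at every ramified place — the two inverse indices of Kottwitz's three-term Euler–Poincaré combination at
the levels `(K♯_η, K, K♯_η ⊓ K)`, whichever of the two is the vertex stabiliser; with ★ R2 `epCombination_apply_mul_toReal_measure` this is `f_EP(1)·ν(I) = −(q−1)∕(2(q+1))`.
[cite: Kottwitz1988, §2 Theorem 2] [cite: Serre1980Trees, Ch. II §1.1–§1.3] -/
theorem inv_relIndex_add_inv_relIndex_of_ramified (he : v.asIdeal.ramificationIdx' w.1.asIdeal ≠ 1)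
    (η : (w.1.adicCompletion L)ˣ) (hη : Valued.v (η : w.1.adicCompletion L) = WithZero.exp (-1 : ℤ)) :
    ((((((glInt 2 (w.1.adicCompletion L)).map (MulAut.conj (glDiagonal 2 (w.1.adicCompletion L) ![1, η])).toMonoidHom).comap
        (((unitaryGroupOfForm (galAdicCompletionMap (L := L) (IsCMField.complexConj L) hw) (placeForm (Matrix.of fun i j : Fin 2 => if i.val + j.val + 1 = 2 then (1 : L) else 0) w.1)).subtype.comp
          (localNonsplitEquiv (IsCMField.complexConj L) (Matrix.of fun i j : Fin 2 => if i.val + j.val + 1 = 2 then (1 : L) else 0) (IsCMField.complexConj_ne_one L) w hw).toMonoidHom :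
          (cmDatum L 2 (Matrix.of fun i j : Fin 2 => if i.val + j.val + 1 = 2 then (1 : L) else 0)).Local v →* GL (Fin 2) (w.1.adicCompletion L)))) ⊓
        cmLocalIntegralLevel L 2 (Matrix.of fun i j : Fin 2 => if i.val + j.val + 1 = 2 then (1 : L) else 0) v).relIndex
        (cmLocalIntegralLevel L 2 (Matrix.of fun i j : Fin 2 => if i.val + j.val + 1 = 2 then (1 : L) else 0) v) : ℝ))⁻¹ +
      ((((((glInt 2 (w.1.adicCompletion L)).map (MulAut.conj (glDiagonal 2 (w.1.adicCompletion L) ![1, η])).toMonoidHom).comap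
        (((unitaryGroupOfForm (galAdicCompletionMap (L := L) (IsCMField.complexConj L) hw) (placeForm (Matrix.of fun i j : Fin 2 => if i.val + j.val + 1 = 2 then (1 : L) else 0) w.1)).subtype.comp
          (localNonsplitEquiv (IsCMField.complexConj L) (Matrix.of fun i j : Fin 2 => if i.val + j.val + 1 = 2 then (1 : L) else 0) (IsCMField.complexConj_ne_one L) w hw).toMonoidHom :
          (cmDatum L 2 (Matrix.of fun i j : Fin 2 => if i.val + j.val + 1 = 2 then (1 : L) else 0)).Local v →* GL (Fin 2) (w.1.adicCompletion L)))) ⊓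
        cmLocalIntegralLevel L 2 (Matrix.of fun i j : Fin 2 => if i.val + j.val + 1 = 2 then (1 : L) else 0) v).relIndex
        (((glInt 2 (w.1.adicCompletion L)).map (MulAut.conj (glDiagonal 2 (w.1.adicCompletion L) ![1, η])).toMonoidHom).comap
        (((unitaryGroupOfForm (galAdicCompletionMap (L := L) (IsCMField.complexConj L) hw) (placeForm (Matrix.of fun i j : Fin 2 => if i.val + j.val + 1 = 2 then (1 : L) else 0) w.1)).subtype.comp
          (localNonsplitEquiv (IsCMField.complexConj L) (Matrix.of fun i j : Fin 2 => if i.val + j.val + 1 = 2 then (1 : L) else 0) (IsCMField.complexConj_ne_one L) w hw).toMonoidHom :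
          (cmDatum L 2 (Matrix.of fun i j : Fin 2 => if i.val + j.val + 1 = 2 then (1 : L) else 0)).Local v →* GL (Fin 2) (w.1.adicCompletion L)))) : ℝ))⁻¹ =
      ((Nat.card (𝓞 ↥(maximalRealSubfield L) ⧸ v.asIdeal) : ℝ) + 1)⁻¹ + 2⁻¹ := by
  rcases relIndex_vertexEdgeLevels_of_ramified L w hw he η hη with ⟨h1, h2⟩ | ⟨h1, h2⟩
  · rw [h1, h2]; push_cast; ring
  · rw [h1, h2]; push_cast; ring

end Summit.HodgeConjecture.HodgeConjecture.Cruxes.H413.K2E3RamifiedPlaceEPIndices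

end
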